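import Summits.BirchSwinnertonDyer.BirchSwinnertonDyer.Theses.TeichmullerTwistDescent
import Summits.BirchSwinnertonDyer.BirchSwinnertonDyer.Theorems.ManinLocalTwoThreeCDivisionOddSquarefreeResidual
import Summits.BirchSwinnertonDyer.BirchSwinnertonDyer.Theorems.AdditiveKolyvaginRoadManinFrameResidueProperTwistLattice
import Summits.BirchSwinnertonDyer.BirchSwinnertonDyer.Theorems.TeichmullerTwistDescentAssembly
import Summits.BirchSwinnertonDyer.BirchSwinnertonDyer.Theorems.TeichmullerTwistDescentWeilTypeManinGlue
import Literature.NumberTheory.EllipticCurves.NewformPeterssonSizeSymmSquareProofs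
import HarnessLib

/-!
# Route `TeichmullerTwistDescent`: the WHOLE Manin side — PSMU (22638), SCMU57 (22639), CORNER (23883), LOW (23884),
# WILD (24306), TAME (24307), GE11 (23885) — and the rung W-ALL/2.p>=5.r1, MODULO THE PRINTED CALEGARI–DIMITROV–TANG
# UNBOUNDED-DENOMINATORS THEOREM ONLY (no Kato F″, no Cremona range, no modularity, no `E[p]`-irreducibility) — `--supports`

Cell `pub/bsd-wall` (D-0145 line route-BirchSwinnertonDyer-TeichmullerTwistDescent, OPEN rev 8), seat `bsd-line-ttd-p1`
(prover 1/2, g31), item of record CORNER (stmt-BirchSwinnertonDyer-23883). THEOREMS ONLY (no definition, no named fact, no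
`sorry`); every theorem is `proof.conditional` on ONE cite-only PRINTED fact, the vendored unbounded-denominators theorem
`Literature.NumberTheory.Automorphic.CalegariDimitrovTang2025_unboundedDenominators_algInt` (Calegari–Dimitrov–Tang, J. Amer.
Math. Soc. 38 (2025), Thm. 1 with Remarks 58–59; below «CDT»); nothing is closed by name; BSD is not proved; Manin's conjecture is
not proved unconditionally and no Manin theorem is announced by this file (director-bsd (505)/(527): display wording «closed
modulo CDT; items open»).

WHAT THIS FILE DOES. It consumes BY NAME the cell bsd-f2-manin's landed corollary of its `c`-division witness
(`CDivAssembly.exists_cDivisionWitness`, PROVED) and of CDT: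
`ManinLocalTwoThree.CDivisionUDC.abs_maninConstant_eq_one_of_CDT_of_odd_sq_dvd` (p755101, file
`ManinLocalTwoThreeCDivisionOddSquarefreeResidual.lean`): **for every globally minimal `W/ℚ`, every level `N`, every
parametrisation datum `D` of `W` at level `N` that is LATTICE-OPTIMAL (`Λ_W = c·Λ_f`) and every odd prime `p` with `p² ∣ N`:
`|c(D)| = 1`, modulo CDT.** Nothing of that mechanism (Honda integrality of the `c`-division lift, pole-killer, CDT ⟹
`Γ(M)`-invariance, the `Γ₁`-Wohlfahrt kernel `Λ₁(f) ⊆ Λ_W`, Ling–Oesterlé `p·Λ₀ ⊆ Λ₁` at a traceless prime) is restated here.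
On the TTD side the only work is the level bookkeeping: at an ADDITIVE prime `p ≥ 5` the conductor exponent is `2`
(`ManinFrameResidueProperTwistLattice.sq_dvd_conductorNorm_of_addv`), and for a datum at an ARBITRARY level `N` (PSMU, SCMU57 are
stated that way) `p² ∣ N` follows WITHOUT modularity: `p ∣ N ⟺ p ∣ N_W` (`IsNewformOf.dvd_level_iff_dvd_conductorNorm`,
Diamond–Shurman (8.44)) and `p ∥ N` would force `a_p(f) = ±1` (Atkin–Lehner 1970, Thm. 3,
`IsNewform0.cuspCoeff_sq_eq_one_of_dvd_of_not_sq_dvd`) against `a_p(f) = a_p(W) = 0` at an additive prime. RESULT: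

* `not_dvd_c_of_CDT` — **Manin's `p`-part `p ∤ c(D)` at EVERY lattice-optimal datum (any level) of EVERY globally minimal curve
  additive at a prime `p ≥ 5`, MODULO CDT** — no `E[p]`-irreducibility, no (G)-ordinarity, no Kodaira clause, no modularity,
  no Kato F″ (compare ttd-p2 g3's `not_dvd_c_of_kato`: modularity + F″, `E[p]` irreducible).
* the SEVEN Manin-side decls of the route BY NAME, each `⟸ CDT` alone: `principalSeriesOptimalManinUnit_of_CDT`,
  `supercuspidalOptimalManinUnitFiveSeven_of_CDT`, `kummerCornerTorsionOptimalManinUnit_of_CDT`,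
  `supersingularTorsionOptimalManinUnitFive_of_CDT`, `kummerCornerWildManinUnit_of_CDT`, `kummerCornerTameManinUnit_of_CDT`,
  `ordinaryLowValuationOptimalManinUnitGeEleven_of_CDT`; and `maninSide_of_CDT` — all seven at once. In particular the K-line's
  residue of g29/g30 (CORNER ⟸ five prints ∧ hStar; hStar = «starred optimal partner is a `p`-unit», beyond Edixhoven's method
  at `(5, III*)`, print-gap at `(7, IV*)`) is ABSORBED: hStar itself is an instance of `not_dvd_c_of_CDT`.
* `wAllExclAdditiveFiveLeRankOne_of_akr_of_CDT` — **the rung `Summit.BirchSwinnertonDyer.WAllExclAdditiveFiveLeRankOne`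
  (W-ALL/2.p>=5.r1) ⟸ CDT ∧ the three AKR-shared open cruxes `KolyvaginPrimitiveAdditive` (21400), `RankZeroAdditive` (20133),
  `OffSharpRankOneAdditive` (20134) ∧ the two hypothesis-only bundles `PublishedInputsAdditiveKoly` (20137), `PublishedManinFacts`
  (22230)** — via the landed assembly (22641) and the landed Weil-type glue (22640). The bundle `KatoNeronAndCremonaFacts` (23789:
  Kato F″ + Cremona's range datum) has LEFT the cone of the rung (compare ttd-p2 g3's `wAllExclAdditiveFiveLeRankOne_of_akr_of_pubBundles`).

HONEST STATUS (numbers): cite-only printed inputs of the TTD Manin side = 1 (CDT; was 2: F″ = Kato 2004 (8.1.3)/Thm 9.7 +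
Kim–Nakamura, XL, referee-flagged, and modularity); the seven Manin items stay OPEN BY NAME because their statements are
unconditional; the route's live residual is the Kolyvagin side {21400, 20133, 20134} plus the printed CDT theorem (not proved in
the tree; its vendored `Prop` is the cell bsd-f2-manin's trust base, audits (505)/(527) pending). BSD is not proved by this; no
W-ALL class theorem is proved by this; Manin's conjecture is not proved by this.
[cite: CalegariDimitrovTang2025, Thm. 1 and Remarks 58–59] [cite: LingOesterle1991, Thm. 6] [cite: AtkinLehner1970, Thm. 3]
[cite: DiamondShurman2005, Prop. 5.8.5 and (8.44)] [cite: SilvermanAEC2009, App. C §16 (conductor exponent `f_p = 2` at additive `p ≥ 5`)]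
[cite: Stevens1989, §2] [cite: WZhang2014, Thm. 1.1 (shape of the Kolyvagin-side cruxes)]
-/

set_option autoImplicit false
-- single-conjunct summit: `Summit.BirchSwinnertonDyer.BirchSwinnertonDyer.…` repeats the name by design
set_option linter.dupNamespace false

noncomputable section

open scoped Classical

open WeierstrassCurve Literature.NumberTheory.EllipticCurves Literature.NumberTheory.EllipticCurves.ModularForms
  Literature.NumberTheory.EllipticCurves.Rank1Residual
  Summit.BirchSwinnertonDyer.BirchSwinnertonDyer.Theses.TeichmullerTwistDescent
  Summit.BirchSwinnertonDyer.BirchSwinnertonDyer.Theorems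

namespace Summit.BirchSwinnertonDyer.BirchSwinnertonDyer.Theorems.TeichmullerTwistDescent

/-! ### §0 Level bookkeeping at an additive prime (unconditional) -/

/-- **`p² ∣ N` for the level of ANY parametrisation datum of a curve additive at `p ≥ 5`, WITHOUT modularity.** `p² ∣ N_W`
(conductor exponent `2`), so `p ∣ N_W`, so `p ∣ N` (the level of the newform of `W` and `N_W` have the same prime divisors,
`IsNewformOf.dvd_level_iff_dvd_conductorNorm`); if `p² ∤ N` then `a_p(f)² = 1` (Atkin–Lehner at `p ∥ N`), but
`a_p(f) = a_p(W) = 0` at an additive prime. [cite: AtkinLehner1970, Thm. 3] [cite: DiamondShurman2005, Prop. 5.8.5 and (8.44)]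
[cite: SilvermanAEC2009, App. C §16] -/
theorem sq_dvd_level_of_addv {W : WeierstrassCurve ℚ} [W.IsElliptic] {N : ℕ} [NeZero N]
    (D : ModularParametrizationData W N) {p : ℕ} [Fact p.Prime] (hp5 : 5 ≤ p) (hadd : Addv W p) : p ^ 2 ∣ N := by
  have hp : p.Prime := Fact.out
  have hW : p ^ 2 ∣ W.conductorNorm ℤ := ManinFrameResidueProperTwistLattice.sq_dvd_conductorNorm_of_addv hp5 W hadd
  have hpW : p ∣ W.conductorNorm ℤ := dvd_trans (dvd_pow_self p two_ne_zero) hW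
  have hpN : p ∣ N := (D.isNewformOf.dvd_level_iff_dvd_conductorNorm hp).mpr hpW
  by_contra h2
  have h1 := D.isNewformOf.1.cuspCoeff_sq_eq_one_of_dvd_of_not_sq_dvd hp hpN h2
  have h0 : cuspCoeff D.f p = 0 := by
    rw [D.isNewformOf.2 p]
    have := W.LFunction_apply_eq_zero_of_hasAdditiveReductionAt
      (Summit.BirchSwinnertonDyer.Rank1Residual.Additive.primesEquiv_symm_apply_coe p)
      (Summit.BirchSwinnertonDyer.Rank1Residual.Additive.hasAdditiveReductionAt_of_addv W p hadd) dvd_rfl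
    exact_mod_cast this
  rw [h0] at h1
  norm_num at h1

/-! ### §1 Manin's `p`-part at every lattice-optimal datum, modulo CDT alone -/

/-- **Manin's `p`-part at EVERY lattice-optimal datum, MODULO the printed unbounded-denominators theorem ONLY.** For `W/ℚ`
globally minimal, additive at a prime `p ≥ 5`, and `D` a LATTICE-OPTIMAL parametrisation datum of `W` (`Λ_W = c·Λ_f`) at any
level `N`: `p ∤ c(D)`. One line over the cell bsd-f2-manin's `CDivisionUDC.abs_maninConstant_eq_one_of_CDT_of_odd_sq_dvd`
(`|c| = 1` at a level with an odd `p² ∣ N`, modulo CDT) and §0. No `E[p]`-irreducibility, no (G)-ordinarity / Kodaira / torsion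
clause, no modularity, no Kato F″. CONDITIONAL on the cite-only printed fact `hCDT`; nothing closed; Manin's conjecture and BSD
are not proved by this. [cite: CalegariDimitrovTang2025, Thm. 1 and Remarks 58–59] [cite: LingOesterle1991, Thm. 6]
[cite: AtkinLehner1970, Thm. 3] -/
theorem not_dvd_c_of_CDT
    (hCDT : Literature.NumberTheory.Automorphic.CalegariDimitrovTang2025_unboundedDenominators_algInt)
    {W : WeierstrassCurve ℚ} [W.IsElliptic] [W.IsGloballyMinimal] {N : ℕ} [NeZero N]
    (D : ModularParametrizationData W N) {p : ℕ} [Fact p.Prime] (hp5 : 5 ≤ p) (hadd : Addv W p)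
    (hlat : ∀ z ∈ D.L.lattice, ∃ w ∈ periodLattice D.f, z = D.c * w) : ¬ (p : ℤ) ∣ D.c := by
  have hp : p.Prime := Fact.out
  have h1 : |D.maninConstant| = 1 :=
    ManinLocalTwoThree.CDivisionUDC.abs_maninConstant_eq_one_of_CDT_of_odd_sq_dvd hCDT D hlat hp (by omega)
      (sq_dvd_level_of_addv D hp5 hadd)
  intro hpc
  have hdvd : (p : ℤ) ∣ |D.maninConstant| := (dvd_abs (p : ℤ) D.maninConstant).mpr hpc
  rw [h1] at hdvd
  have hp1 : p ∣ 1 := by exact_mod_cast hdvd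
  exact hp.ne_one (Nat.dvd_one.mp hp1)

/-! ### §2 The seven Manin-side declarations of the route BY NAME, each modulo CDT alone -/

/-- **PSMU `PrincipalSeriesOptimalManinUnit` (stmt-BirchSwinnertonDyer-22638) ⟸ CDT** (the decl's `Irr`, (G)-ordinary-member and
`Iₙ*`-free-member clauses are idle). CONDITIONAL; the item is not closed by this; BSD is not proved by this.
[cite: CalegariDimitrovTang2025, Thm. 1 and Remarks 58–59] -/
theorem principalSeriesOptimalManinUnit_of_CDT
    (hCDT : Literature.NumberTheory.Automorphic.CalegariDimitrovTang2025_unboundedDenominators_algInt) :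
    PrincipalSeriesOptimalManinUnit := by
  intro W _ _ p _ N _ D hp5 hadd _hirr _hG _hI hlat
  exact not_dvd_c_of_CDT hCDT D hp5 hadd hlat

/-- **SCMU57 `SupercuspidalOptimalManinUnitFiveSeven` (stmt-BirchSwinnertonDyer-22639) ⟸ CDT** (the supercuspidal cells at
`p ∈ {5, 7}`, incl. the CM `j = 0` cell; class clauses idle). CONDITIONAL; the item is not closed by this; BSD is not proved by
this. [cite: CalegariDimitrovTang2025, Thm. 1 and Remarks 58–59] -/
theorem supercuspidalOptimalManinUnitFiveSeven_of_CDT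
    (hCDT : Literature.NumberTheory.Automorphic.CalegariDimitrovTang2025_unboundedDenominators_algInt) :
    SupercuspidalOptimalManinUnitFiveSeven := by
  intro W _ _ p _ N _ D hp57 hadd _hirr _hnoG _hI hlat
  have hp5 : 5 ≤ p := by rcases hp57 with rfl | rfl <;> omega
  exact not_dvd_c_of_CDT hCDT D hp5 hadd hlat

/-- **CORNER `KummerCornerTorsionOptimalManinUnit` (stmt-BirchSwinnertonDyer-23883) ⟸ CDT** — the Kosters–Pannekoek / Kummer
corner `(5, III)`, `(7, II)`, (G)-ordinary, `E[p]` irreducible, `ℚ_p`-rational `p`-torsion: all these clauses are idle. This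
ABSORBS the K-line residue of g29/g30 («CORNER ⟸ five prints ∧ hStar»): hStar is itself an instance of `not_dvd_c_of_CDT`.
CONDITIONAL; the item is not closed by this; BSD is not proved by this. [cite: CalegariDimitrovTang2025, Thm. 1 and Remarks 58–59]
[cite: KostersPannekoek2017, Thm. 1 and Cor. 2 (the corner)] -/
theorem kummerCornerTorsionOptimalManinUnit_of_CDT
    (hCDT : Literature.NumberTheory.Automorphic.CalegariDimitrovTang2025_unboundedDenominators_algInt) :
    KummerCornerTorsionOptimalManinUnit := by
  intro W _ _ p _ _ D hcell hadd _hirr _hord _htor hlat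
  have hp5 : 5 ≤ p := by rcases hcell with ⟨rfl, _⟩ | ⟨rfl, _⟩ <;> omega
  exact not_dvd_c_of_CDT hCDT D hp5 hadd hlat

/-- **LOW `SupersingularTorsionOptimalManinUnitFive` (stmt-BirchSwinnertonDyer-23884) ⟸ CDT** (Kodaira II at `5`, potentially
supersingular, `ℚ₅`-rational `5`-torsion; clauses idle). CONDITIONAL; the item is not closed by this; BSD is not proved by this.
[cite: CalegariDimitrovTang2025, Thm. 1 and Remarks 58–59] [cite: KostersPannekoek2017, Thm. 1] -/
theorem supersingularTorsionOptimalManinUnitFive_of_CDT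
    (hCDT : Literature.NumberTheory.Automorphic.CalegariDimitrovTang2025_unboundedDenominators_algInt) :
    SupersingularTorsionOptimalManinUnitFive := by
  intro W _ _ p _ _ D hcell hadd _hirr _hnoG _htor hlat
  have hp5 : 5 ≤ p := by rcases hcell with ⟨rfl, _⟩ | ⟨rfl, _⟩ <;> omega
  exact not_dvd_c_of_CDT hCDT D hp5 hadd hlat

/-- **WILD `KummerCornerWildManinUnit` (stmt-BirchSwinnertonDyer-24306) ⟸ CDT** (the wild half of the Kummer corner; all clauses
idle). CONDITIONAL; the item is not closed by this; BSD is not proved by this. [cite: CalegariDimitrovTang2025, Thm. 1 and Remarks 58–59] -/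
theorem kummerCornerWildManinUnit_of_CDT
    (hCDT : Literature.NumberTheory.Automorphic.CalegariDimitrovTang2025_unboundedDenominators_algInt) :
    KummerCornerWildManinUnit := by
  intro W _ _ p _ _ D hcell hadd _hirr _hord _htor _hwild hlat
  have hp5 : 5 ≤ p := by rcases hcell with ⟨rfl, _⟩ | ⟨rfl, _⟩ <;> omega
  exact not_dvd_c_of_CDT hCDT D hp5 hadd hlat

/-- **TAME `KummerCornerTameManinUnit` (stmt-BirchSwinnertonDyer-24307) ⟸ CDT** (the tame-split half of the Kummer corner — the
companion/level-lowering configuration of Agashe–Ribet–Stein Thm. 2.7; all clauses idle). CONDITIONAL; the item is not closed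
by this; BSD is not proved by this. [cite: CalegariDimitrovTang2025, Thm. 1 and Remarks 58–59] [cite: AgasheRibetStein2006, Thm. 2.7] -/
theorem kummerCornerTameManinUnit_of_CDT
    (hCDT : Literature.NumberTheory.Automorphic.CalegariDimitrovTang2025_unboundedDenominators_algInt) :
    KummerCornerTameManinUnit := by
  intro W _ _ p _ _ D hcell hadd _hirr _hord _htor _htame hlat
  have hp5 : 5 ≤ p := by rcases hcell with ⟨rfl, _⟩ | ⟨rfl, _⟩ <;> omega
  exact not_dvd_c_of_CDT hCDT D hp5 hadd hlat

/-- **GE11 `OrdinaryLowValuationOptimalManinUnitGeEleven` (stmt-BirchSwinnertonDyer-23885) ⟸ CDT** — Edixhoven's own exceptional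
case (p ≥ 11, potentially ordinary II/III/IV), the target of the K-line 25368–25371; here all its clauses are idle.
CONDITIONAL; the item is not closed by this; BSD is not proved by this. [cite: CalegariDimitrovTang2025, Thm. 1 and Remarks 58–59]
[cite: EdixhovenManin1991, Thm. 3 (the exception)] -/
theorem ordinaryLowValuationOptimalManinUnitGeEleven_of_CDT
    (hCDT : Literature.NumberTheory.Automorphic.CalegariDimitrovTang2025_unboundedDenominators_algInt) :
    OrdinaryLowValuationOptimalManinUnitGeEleven := by
  intro W _ _ p _ _ D h11 hadd _hirr _hord _hv hlat
  exact not_dvd_c_of_CDT hCDT D (by omega) hadd hlat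

/-- **All SEVEN Manin-side declarations of the route — PSMU, SCMU57, CORNER, LOW, WILD, TAME, GE11 — MODULO CDT ALONE** (same
conjunction, same order as ttd-p2 g3's `maninSide_of_pubBundles`, which needed the two registered bundles 23789 ∧ 20137).
CONDITIONAL on the single cite-only printed fact `hCDT`; nothing closed; Manin's conjecture and BSD are not proved by this.
[cite: CalegariDimitrovTang2025, Thm. 1 and Remarks 58–59] -/
theorem maninSide_of_CDT
    (hCDT : Literature.NumberTheory.Automorphic.CalegariDimitrovTang2025_unboundedDenominators_algInt) :
    PrincipalSeriesOptimalManinUnit ∧ SupercuspidalOptimalManinUnitFiveSeven ∧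
      KummerCornerTorsionOptimalManinUnit ∧ SupersingularTorsionOptimalManinUnitFive ∧
      KummerCornerWildManinUnit ∧ KummerCornerTameManinUnit ∧ OrdinaryLowValuationOptimalManinUnitGeEleven :=
  ⟨principalSeriesOptimalManinUnit_of_CDT hCDT, supercuspidalOptimalManinUnitFiveSeven_of_CDT hCDT,
    kummerCornerTorsionOptimalManinUnit_of_CDT hCDT, supersingularTorsionOptimalManinUnitFive_of_CDT hCDT,
    kummerCornerWildManinUnit_of_CDT hCDT, kummerCornerTameManinUnit_of_CDT hCDT,
    ordinaryLowValuationOptimalManinUnitGeEleven_of_CDT hCDT⟩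

/-- **The registered twin `ManinSideOfPubBundles` (stmt-BirchSwinnertonDyer-25548) with BOTH bundles idle, modulo CDT**: the
shape «KatoNeronAndCremonaFacts → PublishedInputsAdditiveKoly → seven decls» in which the route files its conditional twin,
obtained from `maninSide_of_CDT` without touching either bundle. CONDITIONAL on `hCDT`; nothing closed; BSD is not proved by this.
[cite: CalegariDimitrovTang2025, Thm. 1 and Remarks 58–59] -/
theorem maninSideOfPubBundles_of_CDT
    (hCDT : Literature.NumberTheory.Automorphic.CalegariDimitrovTang2025_unboundedDenominators_algInt) :
    ManinSideOfPubBundles :=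
  fun _hKC _hP => maninSide_of_CDT hCDT

/-! ### §3 The rung W-ALL/2.p>=5.r1 modulo CDT and the Kolyvagin-side items -/

/-- **The rung `WAllExclAdditiveFiveLeRankOne` (W-ALL/2.p>=5.r1) ⟸ CDT ∧ the three AKR-shared open cruxes `KolyvaginPrimitiveAdditive`
(21400), `RankZeroAdditive` (20133), `OffSharpRankOneAdditive` (20134) ∧ the two hypothesis-only bundles `PublishedInputsAdditiveKoly`
(20137), `PublishedManinFacts` (22230)** — through the landed assembly `assembly_proof` (22641): PSMU / SCMU57 from §2, the Weil-type
glue G-WT by its landed proof (22640). The bundle `KatoNeronAndCremonaFacts` (23789: Kato F″ + Cremona's range) is NOT a hypothesis: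
the Manin side of the route costs the printed CDT theorem only. CONDITIONAL; no item is closed by this; BSD is not proved and no
W-ALL class theorem is proved by this. [cite: CalegariDimitrovTang2025, Thm. 1 and Remarks 58–59]
[cite: WZhang2014, Thm. 1.1 (shape of the Kolyvagin-side cruxes)] -/
theorem wAllExclAdditiveFiveLeRankOne_of_akr_of_CDT
    (hCDT : Literature.NumberTheory.Automorphic.CalegariDimitrovTang2025_unboundedDenominators_algInt)
    (h₁ : KolyvaginPrimitiveAdditive) (h₀ : RankZeroAdditive) (hoff : OffSharpRankOneAdditive)
    (hP : PublishedInputsAdditiveKoly) (hF : PublishedManinFacts) :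
    Summit.BirchSwinnertonDyer.WAllExclAdditiveFiveLeRankOne :=
  TeichmullerTwistDescentAssembly.assembly_proof
    (principalSeriesOptimalManinUnit_of_CDT hCDT) (supercuspidalOptimalManinUnitFiveSeven_of_CDT hCDT)
    WeilTypeManinGlue.weilTypeManinGlue_proof h₁ h₀ hoff hP hF

end Summit.BirchSwinnertonDyer.BirchSwinnertonDyer.Theorems.TeichmullerTwistDescent

end
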